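import Summits.NavierStokesRegularity.FunctionalMining.PressureMomentRate
import Summits.NavierStokesRegularity.FunctionalMining.C1WeightIntegral
import HarnessLib

/-!
# FunctionalMining — the exact rate of the pressure moments `∫|π|^q`, real `q ≥ 2`, along classical solutions

Search for candidate a priori estimates; no regularity claim. Cell `pub-nsfunc`, prove seat
(gen 10). Companion of `PressureMomentRate` (`q = 2`) for the K0 rows `EP.p.q|T_LD|G1` at a real
exponent `q ≥ 2` (row `EP.p.q=3`): with `π = π_{u(t)}` the zero-mean pressure
(`PressureFunctional`) and the weight `Φ(y) = (y²)^{q/2} = |y|^q`, of class `C¹` for `q ≥ 2`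
(`Real.contDiff_rpow_const_of_le`), the tool `C1Weight.hasDerivWithinAt_integral_comp_of_contDiffOn_one`
gives along every classical unforced solution on `T^d × [a, b]`

`d/dt ∫|π|^q = ∫ q π (π²)^{q/2−1} ∂ₜπ = N_q(u) + ν V_q(u)`,

`∂ₜπ = Δ⁻¹(ν A_u + B_u)` being the split of `PressureMomentRate` (`A_v = −2∑ᵢⱼ∂ᵢ(Δv)ⱼ∂ⱼvᵢ`,
`pressureSqViscousSource`; `B_v = pressureSqInertialSource v`). Packaged as
`HasInitialRate (torusPressureMoment q) (pressureRpowInertialRate q) (pressureRpowViscousRate q)` for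
the heat sieve.
-/

noncomputable section

open MeasureTheory Finset Set Filter Topology
open scoped InnerProductSpace RealInnerProductSpace ContDiff

namespace Summit.NavierStokesRegularity.FunctionalMining

open Literature.Analysis.FunctionSpaces Literature.Analysis.FluidPDE

variable {d : Type*} [Fintype d] [DecidableEq d]

/-! ## 1. The rates -/

/-- **Viscous (heat-flow) rate of `∫|π|^q`**: `V_q(v) = ∫ q π_v (π_v²)^{q/2−1} · Δ⁻¹A_v`.
[ours; bookkeeping] -/
def pressureRpowViscousRate (q : ℝ) (v : UnitAddTorus d → EuclideanSpace ℝ d) : ℝ :=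
  ∫ x, q * (pressureOf v x * (pressureOf v x ^ 2) ^ (q / 2 - 1)) *
    Torus.invLaplacian (pressureSqViscousSource v) x

/-- **Inertial rate of `∫|π|^q`**: `N_q(v) = ∫ q π_v (π_v²)^{q/2−1} · Δ⁻¹B_v`. [ours; bookkeeping] -/
def pressureRpowInertialRate (q : ℝ) (v : UnitAddTorus d → EuclideanSpace ℝ d) : ℝ :=
  ∫ x, q * (pressureOf v x * (pressureOf v x ^ 2) ^ (q / 2 - 1)) *
    Torus.invLaplacian (pressureSqInertialSource v) x

/-! ## 2. The time derivative of the source (as in `PressureMomentRate`) -/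

/-- **`∂ₜ(−s_u) = ν A_{u(t)} + B_{u(t)}` along classical unforced solutions** (gradient transport,
`∂ᵢ∂ⱼp = ∂ᵢ∂ⱼπ`; the identity inside `hasDerivWithinAt_torusPressureMoment_two`, stated on its
own). [ours] -/
theorem timeDerivWithin_neg_gradSqTrace [Nonempty d] {a b ν : ℝ}
    {u : ℝ → UnitAddTorus d → EuclideanSpace ℝ d} {p : ℝ → UnitAddTorus d → ℝ}
    (h : Torus.IsClassicalNSSolutionOn (Icc a b) ν 0 u p) (hab : a < b) {t : ℝ} (ht : t ∈ Icc a b) :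
    Torus.timeDerivWithin (Icc a b) (fun s y => -gradSqTrace (u s) y) t =
      fun x => ν * pressureSqViscousSource (u t) x + pressureSqInertialSource (u t) x := by
  have hU : UniqueDiffOn ℝ (Icc a b) := uniqueDiffOn_Icc hab
  funext x
  have hD : ∀ i j, HasDerivWithinAt (fun s => Torus.partialDeriv i (u s) x j)
      (Torus.partialDeriv i (Torus.timeDerivWithin (Icc a b) u t) x j) (Icc a b) t :=
    fun i j => GradientTensor.hasDerivWithinAt_partialDeriv_apply h hab ht i j x
  have hval : ∀ i j, Torus.partialDeriv i (Torus.timeDerivWithin (Icc a b) u t) x j =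
      ν * Torus.partialDeriv i (Torus.laplacian (u t)) x j -
        Torus.partialDeriv i (Torus.partialDeriv j (p t)) x -
        (∑ k, Torus.partialDeriv i (u t) x k * Torus.partialDeriv k (u t) x j) -
        ∑ k, u t x k * Torus.partialDeriv k (Torus.partialDeriv i (u t)) x j := by
    intro i j
    have e := GradientTensor.timeDerivWithin_partialDeriv_apply h hab ht i j x
    rw [Torus.timeDerivWithin, (hD i j).derivWithin (hU t ht)] at e
    rw [e]
    have h0 : Torus.partialDeriv i ((0 : ℝ → UnitAddTorus d → EuclideanSpace ℝ d) t) x j = 0 := by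
      simp [Torus.partialDeriv, Torus.lineDeriv]
    rw [h0, add_zero]
  have hpp : ∀ i j, Torus.partialDeriv i (Torus.partialDeriv j (p t)) x =
      Torus.partialDeriv i (Torus.partialDeriv j (pressureOf (u t))) x := by
    intro i j
    rw [pressureOf_eq_pressure_sub_integral h hab ht]
    congr 1
    funext y
    exact (partialDeriv_fun_sub_const (p t) _ j y).symm
  have hsum : HasDerivWithinAt (fun s => -gradSqTrace (u s) x)
      (-(∑ i, ∑ j, (Torus.partialDeriv i (Torus.timeDerivWithin (Icc a b) u t) x j *
        Torus.partialDeriv j (u t) x i +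
        Torus.partialDeriv i (u t) x j *
          Torus.partialDeriv j (Torus.timeDerivWithin (Icc a b) u t) x i))) (Icc a b) t := by
    have := HasDerivWithinAt.fun_sum (u := Finset.univ) fun i _ =>
      HasDerivWithinAt.fun_sum (u := Finset.univ) fun j _ => (hD i j).fun_mul (hD j i)
    exact this.neg
  rw [Torus.timeDerivWithin, hsum.derivWithin (hU t ht)]
  have hswap : ∑ i, ∑ j, Torus.partialDeriv i (u t) x j *
      Torus.partialDeriv j (Torus.timeDerivWithin (Icc a b) u t) x i =
      ∑ i, ∑ j, Torus.partialDeriv i (Torus.timeDerivWithin (Icc a b) u t) x j *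
        Torus.partialDeriv j (u t) x i := by
    rw [Finset.sum_comm]
    exact Finset.sum_congr rfl fun i _ => Finset.sum_congr rfl fun j _ => by ring
  have hDG : ∀ i j, Torus.partialDeriv i (Torus.timeDerivWithin (Icc a b) u t) x j *
      Torus.partialDeriv j (u t) x i =
      ν * (Torus.partialDeriv i (Torus.laplacian (u t)) x j * Torus.partialDeriv j (u t) x i) +
        (-Torus.partialDeriv i (Torus.partialDeriv j (pressureOf (u t))) x -
          (∑ k, Torus.partialDeriv i (u t) x k * Torus.partialDeriv k (u t) x j) -
          ∑ k, u t x k * Torus.partialDeriv k (Torus.partialDeriv i (u t)) x j) *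
          Torus.partialDeriv j (u t) x i := by
    intro i j
    rw [hval i j, hpp i j]
    ring
  simp only [Finset.sum_add_distrib, hswap]
  simp only [hDG, Finset.sum_add_distrib, ← Finset.mul_sum]
  simp only [pressureSqViscousSource, pressureSqInertialSource]
  ring

/-! ## 3. The weight `|y|^q = (y²)^{q/2}` -/

/-- `|y|^q = (y²)^{q/2}`. [folklore] -/
theorem abs_rpow_eq_sq_rpow (y q : ℝ) : |y| ^ q = (y ^ 2) ^ (q / 2) := by
  rw [← sq_abs, ← Real.rpow_natCast, ← Real.rpow_mul (abs_nonneg y)]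
  congr 1
  push_cast
  ring

/-- The weight `y ↦ (y²)^{q/2}` is `C¹` for `q ≥ 2`. [folklore] -/
theorem contDiff_one_sq_rpow {q : ℝ} (hq : 2 ≤ q) :
    ContDiff ℝ 1 (fun y : ℝ => (y ^ 2) ^ (q / 2)) := by
  have hp1 : (1 : ℝ) ≤ q / 2 := by linarith
  exact (Real.contDiff_rpow_const_of_le (p := q / 2) (n := 1) (by exact_mod_cast hp1)).comp
    (contDiff_id.pow 2)

/-- `d/dy (y²)^{q/2} = q y (y²)^{q/2−1}` for `q ≥ 2`. [folklore] -/
theorem deriv_sq_rpow {q : ℝ} (hq : 2 ≤ q) (y : ℝ) :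
    deriv (fun y : ℝ => (y ^ 2) ^ (q / 2)) y = q * (y * (y ^ 2) ^ (q / 2 - 1)) := by
  have hp1 : (1 : ℝ) ≤ q / 2 := by linarith
  have h1 : HasDerivAt (fun y : ℝ => y ^ 2) (2 * y) y := by
    have h := hasDerivAt_pow 2 y
    simpa using h
  have h2 := h1.rpow_const (p := q / 2) (Or.inr hp1)
  rw [h2.deriv]
  ring

/-! ## 4. The exact rate -/

/-- **`d/dt ∫|π|^q = N_q + νV_q` along classical unforced solutions on `T^d`, real `q ≥ 2`.** [ours] -/
theorem hasDerivWithinAt_torusPressureMoment_rpow [Nonempty d] {a b ν : ℝ}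
    {u : ℝ → UnitAddTorus d → EuclideanSpace ℝ d} {p : ℝ → UnitAddTorus d → ℝ}
    (h : Torus.IsClassicalNSSolutionOn (Icc a b) ν 0 u p) (hab : a < b) {q : ℝ} (hq : 2 ≤ q)
    {t : ℝ} (ht : t ∈ Icc a b) :
    HasDerivWithinAt (fun s => torusPressureMoment q (u s))
      (pressureRpowInertialRate q (u t) + ν * pressureRpowViscousRate q (u t)) (Icc a b) t := by
  have hU : UniqueDiffOn ℝ (Icc a b) := uniqueDiffOn_Icc hab
  have hint : (interior (Icc a b)).Nonempty := by
    rw [interior_Icc]; exact nonempty_Ioo.2 hab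
  have hu : Torus.IsSmoothSpaceTimeOn (Icc a b) u := h.smooth_velocity
  have hut : Torus.IsSmooth (u t) := hu.isSmooth_slice ht
  have hσ : Torus.IsSmoothSpaceTimeOn (Icc a b) (fun s x => -gradSqTrace (u s) x) := by
    have h1 : Torus.IsSmoothSpaceTimeOn (Icc a b) (fun s x => gradSqTrace (u s) x) :=
      Torus.IsSmoothSpaceTimeOn.sum fun i _ => Torus.IsSmoothSpaceTimeOn.sum fun j _ =>
        ((hu.partialDeriv hU i).apply j).mul ((hu.partialDeriv hU j).apply i)
    exact h1.neg
  have hP : Torus.IsSmoothSpaceTimeOn (Icc a b) (fun s => pressureOf (u s)) :=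
    hσ.invLaplacian (convex_Icc a b) hint
  -- the functional with the `C¹` weight `(y²)^{q/2}`
  have hF : (fun s => torusPressureMoment q (u s)) =
      fun s => ∫ x, (fun y : ℝ => (y ^ 2) ^ (q / 2)) (pressureOf (u s) x) := by
    funext s
    unfold torusPressureMoment
    exact integral_congr_ae (ae_of_all _ fun x => abs_rpow_eq_sq_rpow _ q)
  rw [hF]
  have hΦ : ContDiffOn ℝ 1 (fun y : ℝ => (y ^ 2) ^ (q / 2)) univ := (contDiff_one_sq_rpow hq).contDiffOn
  have hD := C1Weight.hasDerivWithinAt_integral_comp_of_contDiffOn_one hab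
    (θ := fun s x => pressureOf (u s) x) hP isOpen_univ hΦ (fun _ _ _ => mem_univ _) ht
  refine hD.congr_deriv ?_
  simp only [deriv_sq_rpow hq]
  -- `∂ₜπ = Δ⁻¹(νA + B)`
  have hdπ : ∀ x, Torus.timeDerivWithin (Icc a b) (fun s x => pressureOf (u s) x) t x =
      ν * Torus.invLaplacian (pressureSqViscousSource (u t)) x +
        Torus.invLaplacian (pressureSqInertialSource (u t)) x := by
    intro x
    have e3 : Torus.timeDerivWithin (Icc a b) (fun s => pressureOf (u s)) t x =
        Torus.invLaplacian (Torus.timeDerivWithin (Icc a b) (fun s y => -gradSqTrace (u s) y) t) x :=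
      Torus.timeDerivWithin_invLaplacian hab hσ ht x
    have hA : Torus.IsSmooth (pressureSqViscousSource (u t)) := isSmooth_pressureSqViscousSource hut
    have hB : Torus.IsSmooth (pressureSqInertialSource (u t)) := isSmooth_pressureSqInertialSource hut
    have hνA : Torus.IsSmooth (ν • pressureSqViscousSource (u t)) := hA.const_smul ν
    have e4 : (fun x => ν * pressureSqViscousSource (u t) x + pressureSqInertialSource (u t) x) =
        (ν • pressureSqViscousSource (u t)) + pressureSqInertialSource (u t) := by
      funext y; simp [smul_eq_mul]
    show Torus.timeDerivWithin (Icc a b) (fun s => pressureOf (u s)) t x = _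
    rw [e3, timeDerivWithin_neg_gradSqTrace h hab ht, e4, Torus.invLaplacian_add hνA hB,
      Torus.invLaplacian_const_smul ν _ hA]
    simp [smul_eq_mul]
  simp_rw [hdπ]
  -- integrate
  have hπ : Torus.IsSmooth (pressureOf (u t)) := isSmooth_pressureOf hut
  have hA : Torus.IsSmooth (pressureSqViscousSource (u t)) := isSmooth_pressureSqViscousSource hut
  have hB : Torus.IsSmooth (pressureSqInertialSource (u t)) := isSmooth_pressureSqInertialSource hut
  have hw : Continuous fun x => q * (pressureOf (u t) x * (pressureOf (u t) x ^ 2) ^ (q / 2 - 1)) :=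
    continuous_const.mul (hπ.continuous.mul ((hπ.continuous.pow 2).rpow_const fun x =>
      Or.inr (by linarith)))
  have iA : Integrable (fun x => ν * (q * (pressureOf (u t) x * (pressureOf (u t) x ^ 2) ^ (q / 2 - 1)) *
      Torus.invLaplacian (pressureSqViscousSource (u t)) x)) :=
    ((hw.mul (Torus.isSmooth_invLaplacian hA).continuous).integrable_unitAddTorus).const_mul ν
  have iB : Integrable (fun x => q * (pressureOf (u t) x * (pressureOf (u t) x ^ 2) ^ (q / 2 - 1)) *
      Torus.invLaplacian (pressureSqInertialSource (u t)) x) :=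
    (hw.mul (Torus.isSmooth_invLaplacian hB).continuous).integrable_unitAddTorus
  have e2 : ∀ x, q * (pressureOf (u t) x * (pressureOf (u t) x ^ 2) ^ (q / 2 - 1)) *
      (ν * Torus.invLaplacian (pressureSqViscousSource (u t)) x +
        Torus.invLaplacian (pressureSqInertialSource (u t)) x) =
      ν * (q * (pressureOf (u t) x * (pressureOf (u t) x ^ 2) ^ (q / 2 - 1)) *
        Torus.invLaplacian (pressureSqViscousSource (u t)) x) +
      q * (pressureOf (u t) x * (pressureOf (u t) x ^ 2) ^ (q / 2 - 1)) *
        Torus.invLaplacian (pressureSqInertialSource (u t)) x := by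
    intro x; ring
  simp_rw [e2]
  rw [integral_add iA iB, integral_const_mul, pressureRpowViscousRate, pressureRpowInertialRate]
  ring

/-- **The initial rates of the rows `EP.p.q`, real `q ≥ 2`**:
`HasInitialRate (torusPressureMoment q) N_q V_q` on `T³`. [ours] -/
theorem hasInitialRate_torusPressureMoment_rpow {q : ℝ} (hq : 2 ≤ q) :
    HasInitialRate (d := d) (torusPressureMoment q) (pressureRpowInertialRate q)
      (pressureRpowViscousRate q) := by
  intro hd ν _ a b hab u p hsol _
  haveI : Nonempty d := Fintype.card_pos_iff.mp (by omega)
  exact hasDerivWithinAt_torusPressureMoment_rpow hsol hab hq (left_mem_Icc.2 hab.le)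

end Summit.NavierStokesRegularity.FunctionalMining
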